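import Summits.PneNP.PneNP.Theorems.ClusUniversalCertificateCoordDefs
import Mathlib
import HarnessLib

/-!
# Route ClusUniversalCertificate — path `coord` on the crux `UniversalCertAll` (stmt-PneNP-19683): invariance under block-zero-preserving
automorphisms (rung F-N1, cell pnp-ideate, planner p1 g6; registered skeleton HOME/pnp-ideate-p1/lines/layer.lean v6 sha16 ed80fa781593c29a,
path `coord`; stub `stub_inv`, M, WANTED for provers on STATUS 08:49Z)

The registered stub `stub_inv` of p1's path `coord`, BY NAME, against the objects of `ClusUniversalCertificateCoordDefs.lean` (verbatim copies of
the skeleton's): a linear automorphism `g` of `𝔽₂^M` preserving the block-zero patterns (`BZP blk g`) transports the mixed certificate `UCMix` from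
`g(Y)` back to `Y`.

PROOF.  Flats are transported by any linear equivalence `φ`, with their dimension (`AffineSubspace.map`, `AffineSubspace.map_direction`,
`Submodule.equivMapOfInjective`), so the certificate codimension can only drop: `acodim (φ Y) (φ y) ≤ acodim Y y` for `y ∈ Y` — stated once for a
general linear equivalence and a general dimension threshold (`sInf_flatCodim_image_le`, reused by the transfer stub); the left side of `UCMix` is a
sum over `Y` re-indexed through `g` (`Finset.sum_image`), and `BZP` makes every zero count `zcount blk j` of `g(Y)` equal to that of `Y`.

HONEST FRAMING: ONE registered M-sized stub (transport bookkeeping) of an OPEN crux of route ClusUniversalCertificate; the load-bearing stub of the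
path, `stub_cllZeroRare`, is OPEN and XL; FRONTIER rung F-N1 — nothing here bears on P vs NP.
-/

set_option linter.dupNamespace false -- `Summit.PneNP.PneNP.…`: summit = sub-problem name (D-0017 single-conjunct layout)

-- BEGIN BODY
namespace Summit.PneNP.PneNP.Theorems.ClusCoord

open Finset

/-! ## Transport of flats inside `Y` along a linear equivalence -/

/-- **Transport.** For a linear equivalence `φ : V ≃ W`, a finite `Y ⊆ V`, `y ∈ Y` and any threshold `N`: the least `c` with a flat through `φ y`
inside `φ(Y)` of dimension `≥ N − c` is at most the least such `c` for `y` and `Y` (push the optimal flat forward). -/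
theorem sInf_flatCodim_image_le {V W : Type*} [AddCommGroup V] [Module (ZMod 2) V] [AddCommGroup W] [Module (ZMod 2) W]
    [DecidableEq W] (φ : V ≃ₗ[ZMod 2] W) (Y : Finset V) {y : V} (hy : y ∈ Y) (N : ℕ) :
    sInf {c : ℕ | ∃ A : AffineSubspace (ZMod 2) W, φ y ∈ A ∧ (∀ z ∈ A, z ∈ Y.image φ) ∧
        N ≤ Module.finrank (ZMod 2) A.direction + c} ≤
      sInf {c : ℕ | ∃ A : AffineSubspace (ZMod 2) V, y ∈ A ∧ (∀ z ∈ A, z ∈ Y) ∧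
        N ≤ Module.finrank (ZMod 2) A.direction + c} := by
  -- the set for `(Y, y)` is nonempty: the singleton flat `{y}` with `c = N`
  have hne : {c : ℕ | ∃ A : AffineSubspace (ZMod 2) V, y ∈ A ∧ (∀ z ∈ A, z ∈ Y) ∧
      N ≤ Module.finrank (ZMod 2) A.direction + c}.Nonempty := by
    refine ⟨N, affineSpan (ZMod 2) {y}, mem_affineSpan (ZMod 2) (Set.mem_singleton y), ?_, Nat.le_add_left _ _⟩
    intro z hz
    rw [AffineSubspace.mem_affineSpan_singleton] at hz
    rw [hz]; exact hy
  obtain ⟨A, hyA, hAY, hc⟩ := Nat.sInf_mem hne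
  apply Nat.sInf_le
  -- push `A` forward along `φ`
  let f : V →ᵃ[ZMod 2] W := φ.toLinearMap.toAffineMap
  refine ⟨A.map f, AffineSubspace.mem_map.mpr ⟨y, hyA, rfl⟩, ?_, ?_⟩
  · intro z hz
    obtain ⟨x, hx, rfl⟩ := AffineSubspace.mem_map.mp hz
    exact Finset.mem_image.mpr ⟨x, hAY x hx, rfl⟩
  · have hdir : Module.finrank (ZMod 2) (A.map f).direction = Module.finrank (ZMod 2) A.direction := by
      rw [AffineSubspace.map_direction]
      exact (Submodule.equivMapOfInjective f.linear φ.injective A.direction).finrank_eq.symm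
    rw [hdir]; exact hc

variable {M n : ℕ}

/-- The certificate codimension does not increase under a linear automorphism of `𝔽₂^M` applied to `Y` and `y ∈ Y`. -/
theorem acodim_image_le (Y : Finset (Fin M → ZMod 2)) (g : (Fin M → ZMod 2) ≃ₗ[ZMod 2] (Fin M → ZMod 2))
    {y : Fin M → ZMod 2} (hy : y ∈ Y) : acodim M (Y.image fun z => g z) (g y) ≤ acodim M Y y := by
  unfold acodim
  exact sInf_flatCodim_image_le g Y hy M

/-- A block-zero-preserving automorphism preserves every zero count `Z_j`. -/
theorem zcount_image_eq (blk : Fin M → Fin n) (g : (Fin M → ZMod 2) ≃ₗ[ZMod 2] (Fin M → ZMod 2)) (hg : BZP blk g)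
    (j : Fin n) (Y : Finset (Fin M → ZMod 2)) : zcount blk j (Y.image fun y => g y) = zcount blk j Y := by
  unfold zcount
  rw [Finset.filter_image, Finset.card_image_of_injective _ g.injective]
  congr 1
  apply Finset.filter_congr
  intro y _
  exact hg y j

/-- **Registered stub `stub_inv`** of the path `coord` (stmt-PneNP-19683), BY NAME: a block-zero-preserving linear automorphism transports the
mixed certificate from `g(Y)` to `Y`. -/
theorem stub_inv : ∀ M n : ℕ, ∀ blk : Fin M → Fin n, ∀ Y : Finset (Fin M → ZMod 2),
    ∀ g : (Fin M → ZMod 2) ≃ₗ[ZMod 2] (Fin M → ZMod 2), BZP blk g → UCMix M n blk (Y.image fun y => g y) → UCMix M n blk Y := by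
  intro M n blk Y g hg h
  unfold UCMix at h ⊢
  -- the right-hand sides agree
  have hR : ∑ j : Fin n, (2 : ℤ) ^ (bsize blk j) * (zcount blk j (Y.image fun y => g y) : ℤ) =
      ∑ j : Fin n, (2 : ℤ) ^ (bsize blk j) * (zcount blk j Y : ℤ) :=
    Finset.sum_congr rfl fun j _ => by rw [zcount_image_eq blk g hg j Y]
  -- the left-hand side of `g(Y)` re-indexed through `g`
  have hL : ∑ y' ∈ Y.image (fun y => g y),
      (((M : ℤ) - (acodim M (Y.image fun y => g y) y' : ℤ)) - ∑ j : Fin n, ((bsize blk j : ℤ) - 1)) =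
      ∑ y ∈ Y, (((M : ℤ) - (acodim M (Y.image fun y => g y) (g y) : ℤ)) - ∑ j : Fin n, ((bsize blk j : ℤ) - 1)) :=
    Finset.sum_image fun y _ z _ hyz => g.injective hyz
  rw [hL, hR] at h
  -- termwise comparison
  refine le_trans (Finset.sum_le_sum fun y hy => ?_) h
  have h1 : (acodim M (Y.image fun z => g z) (g y) : ℤ) ≤ (acodim M Y y : ℤ) := by
    exact_mod_cast acodim_image_le Y g hy
  linarith

end Summit.PneNP.PneNP.Theorems.ClusCoord
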